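import Mathlib
import Literature.MathematicalPhysics.QuantumFieldTheory.MagnenRivasseauSeneor1993.MRS93HomotheticCovariantA27
import Literature.MathematicalPhysics.QuantumFieldTheory.MagnenRivasseauSeneor1993.MRS93ConstantBackgroundDictionary
import Literature.MathematicalPhysics.QuantumFieldTheory.MagnenRivasseauSeneor1993.MRS93CurvatureDecomposition
import HarnessLib

/-!
# Magnen–Rivasseau–Sénéor, *Construction of YM₄ with an infrared cutoff* (CMP 155, 1993), §IV p.357: the covariant
# integration by parts behind (IV.15)/(IV.16) at a CONSTANT background — «the reader can check that at least for su(2)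
# the formula of integration by parts is still true up to a term proportional to [A′_{l,μ}, A′_{l,ν}][A′_{s,μ}, A′_{s,ν}]»
# — kernel-checked for a GENERAL constant su(2) background, with the remainder made explicit

statement-level skeleton of published theorems with citation tags; proofs where landed; nothing here is a claim about the
Yang–Mills mass gap, about continuum YM₄ on T⁴, or about the Clay problem

**Citation header (reproduction of PUBLISHED work).** J. Magnen, V. Rivasseau, R. Sénéor, *Construction of YM₄ with an infrared
cutoff*, Commun. Math. Phys. **155** (1993) 325–383 [MagnenRivasseauSeneor1993], §IV p.357 [PDF 33] tl.2–17, (IV.10)–(IV.16) p.356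
[PDF 32], p.353 [PDF 29] tl.29–32; §II.A (II.1), (II.5) pp.328–329; §VI (VI.6) p.369. Page images (decoded 600-dpi scan, journal p =
PDF p + 324): `run/shared/lean/pub/pub-balaban-gaps/pub-balaban-gaps-mrs-lit-2/g9/renders/p33_crop_r300-2400_s2.png` (p.357 tl.2–17),
`p32_crop_r300-3000_s2.png` ((IV.10)–(IV.13)), `p32_crop_r2900-5700_s2.png` ((IV.14)–(IV.16)), `p30_crop_r4300-5700_s2.png` ((IV.4)).
Cell pub-balaban-gaps (YM blitz, track G3), seat mrs-lit-2 (gen 9); companion record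
`run/shared/lean/pub/pub-balaban-gaps/g3/MRS-AS-PRINTED-estimates.md` §3 finding (l), §7. Imports (by name, nothing re-declared): this seat's
file 15 `MRS93HomotheticCovariantA27` (the three 12 × 12 forms `HomotheticA27.formLap/divSq/crossM/formDiv/formCross/formCurv` for an
arbitrary quadruple of 3 × 3 matrices `P_μ`, and `divSq_eq_sum`/`crossM_eq_sum`), file 22 `MRS93ConstantBackgroundDictionary` (the
zero-mode background `ConstantBackground.zeroModeBG`, `bgVec`, `convCross_of_left_zeroMode`, `dCoeff_eq_smul`; through it mrs-lit-1's
(II.5) `MainStatement.covDCoeff`), file 16 `MRS93CurvatureDecomposition` (`SectIV.FieldJet`, `curvature` = (II.1), `covDeriv`, `curvature_add`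
= (IV.4)), and through them file 9 (`FeynmanGauge.Pmat` = (VI.6)) and mrs-lit-1's `TruncatedGauge.bracket` (the su(2) bracket p.328 = the
cross product on `ℝ³`, `bracket_eq_crossProduct`).

**What the paper prints (verbatim, from the page images).**
* p.357 tl.2–17: «Finally L in (IV.15) is a correction term which is treated as an interaction. This term contains indeed either
  derivatives acting on B′_l or commutators of the background field [A′_{l,μ}, A′_{l,ν}] which are dominable as explained above. Indeed
  usually when one combines the quadratic piece Σ_μΣ_ν(∂_μA_ν)² − (∂_μA_ν)(∂_νA_μ) coming from F₂ with the homothetic gauge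
  condition ζ(Σ_μ∂_μA_μ)(Σ_ν∂_νA_ν) one needs an integration by parts, so that the gauge condition combines with the term with the
  minus sign, leaving the term Σ_μΣ_ν(∂_μA_ν)² + (ζ − 1)Σ_μΣ_ν(∂_μA_ν)(∂_νA_μ) which corresponds to the homothetic propagator
  1/p²(δ_μν − (1 − ζ⁻¹)p_μp_ν/p²). In our case this integration by parts is no longer exact for two reasons. First the partial derivatives
  are replaced by covariant derivatives. However if the background field is constant the reader can check that at least for su(2) the
  formula of integration by parts is still true up to a term proportional to [A′_{l,μ}, A′_{l,ν}][A′_{s,μ}, A′_{s,ν}]. The fact that the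
  field B̄′_l is piecewise constant then gives an error term containing derivatives of this field.» («F₂» [sic], for F²; the bar on
  B̄′_l = the piecewise-constant average of B′_l, p.356 tl.2–7.)
* (IV.15) p.356: «((∇_B̄′_l)_μ(A′_s)_ν − (∇_B̄′_l)_ν(A′_s)_μ)²_CSFR + ζ(∇_B̄′_l · A′_s)²_CSFR = ⟨A′_sΔ_BA′_s⟩ + L(B′_l, A′_s, γ).»;
  (IV.16) p.356: «Δ_{B,J,Δ} ≡ ((∇_B̄′_l)_σ(κʲ)^{1/2}χ_Δ(κʲ)^{1/2}(∇_B̄′_l)_σδ_μν + (ζ − 1)(∇_B̄′_l)_μ(κʲ)^{1/2}χ_Δ(κʲ)^{1/2}(∇_B̄′_l)_ν).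
  This operator is clearly positive but not strictly positive».
* (IV.10) p.356 tl.10: «F²(A′)_CSFR = ((∇_B′_l)_μ(A′_s)_ν − (∇_B′_l)_ν(A′_s)_μ)²_CSFR + H(A′_s, B′_l)», (IV.12) p.356 tl.14–15:
  «H = (terms with at least one G, one F_μν(A′_s), one commutator [A′_s, A′_s] or one difference δB′_l)_CSFR».
* p.353 tl.29–32: «Let us consider two such background fields; if they occur in the form of a commutator, there is no problem because
  the decoupled effective action for the B field contains a commutator squared [in F⁴(B)] and the situation is therefore analogous to
  that of a positive polynomial coupling such as φ⁴ (see e.g. [R]).»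
* p.328 tl.28: «the covariant derivative is D_μ = ∂_μ − λ[A_μ, ·]»; (II.1) p.328 tl.30: «F_μν = (∂_μA_ν − ∂_νA_μ) − λ[A_μ, A_ν]»;
  p.328 tl.32–33: «in the three dimensional su(2) space, the commutator is a wedge product»; p.369 tl.22–23: «It is convenient to
  define P_μ such that D_μ = iP_μ (in Fourier space)» with (VI.6) the matrices `P_μ` of the two-component background of p.369 tl.11
  «a field B with only two non-zero components B₁¹ = x/λ and B₂² = y/λ» (file 9 `FeynmanGauge.Pmat`); p.354 tl.25–26: «∂B ≅ 0 for a
  low momentum field».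

**What this file PROVES (kernel; zero `sorry`, zero named facts, nothing assumed).** Throughout, a CONSTANT su(2)-valued background is a
quadruple of real colour vectors `b : Fin 4 → Fin 3 → ℝ` (all four components free — not only the two-component zero mode of p.369),
`λ ∈ ℝ` the coupling, `k ∈ ℝ⁴` a momentum.
* §1 `adMat c` = the matrix of `c ⨯₃ ·` (the adjoint action of su(2) ≅ (ℝ³, ×), complexified); `adMat_commutator`: `[ad c, ad d] =
  ad(c ⨯₃ d)` (Jacobi); `adMat_conjTranspose`: `ad c` is anti-Hermitian for real `c`.
* §2 `PmatBG k λ b μ := k_μ·1 + iλ·ad(b_μ)` — the momentum-space covariant derivative of a constant background, «D_μ = iP_μ»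
  (`I_smul_PmatBG_mulVec`: `i·P_μe = ik_μe − λ b_μ ⨯₃ e`, i.e. (II.5) `D_μ = ∂_μ − λ[B_μ, ·]` at `∂ → ik`); `PmatBG_conjTranspose`: `P_μ`
  is Hermitian; **`PmatBG_commutator`: `[P_μ, P_ν] = −λ²·ad(b_μ ⨯₃ b_ν)`**, equivalently (`PmatBG_commutator_eq_curvature`) `= λ·ad F_μν(B̄)`
  with `F` the printed (II.1) at `∂B̄ = 0` (file 16's `SectIV.curvature` of the constant jet: `curvature_constJet`, `F_μν(B̄) = −λ[B̄_μ, B̄_ν]`);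
  dictionary: `PmatBG_bg2` — at the two-component background `b = (0, u e₁, v e₂, 0)` these are EXACTLY the printed (VI.6) matrices
  `FeynmanGauge.Pmat k (λu) (λv)`; `covDCoeff_constBG` — mrs-lit-1's typed (II.5) `covDCoeff` at the zero-mode background `constBG b`
  is `i·PmatBG` (generalising file 22's `covDCoeff_zeroModeBG` from two to four components; `constBG_bg2`: `constBG (bg2 u v) =
  zeroModeBG u v`).
* §3 **p.357 tl.12–16 as a theorem** (`divSq_sub_crossM_constBG`; for mrs-lit-1's typed (II.5) verbatim: §3b `covDCoeff_ibp_constBG`): for every constant background, coupling, momentum and every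
  `a : Fin 4 → ℂ³`, `‖Σ_μ P_μa_μ‖² − Σ_{μν}⟨P_νa_μ, P_μa_ν⟩ = λ²·T(b, a)` with **`T(b, a) := Σ_{μν} (b_μ ⨯₃ b_ν)·(ā_μ ⨯₃ a_ν)`**
  (`commTerm`) — the Parseval form of «∫(∇·A)² = ∫ΣΣ(∇_μA_ν)(∇_νA_μ) + a term proportional to [B̄_μ, B̄_ν][A_μ, A_ν]» (the two
  integrations by parts are the Hermiticity of `P_μ`, file 15's `divSq_eq_sum`/`crossM_eq_sum`; the remainder is `[P_μ, P_ν]` contracted,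
  rewritten with the invariance of the trace form `x·(c ⨯₃ y) = c·(y ⨯₃ x)`). It holds for all four-component constant backgrounds (so
  «at least for su(2)» is confirmed for su(2) with nothing special to two components), and `T = 0` whenever the `b_μ` pairwise commute
  (`commTerm_eq_zero_of_cross_eq_zero`: for an abelian constant background the integration by parts is exact).
  COROLLARIES for (IV.15) at a constant background (cut-off factors collapsed as in (VI.2)/(VI.9)): with file 15's forms of the operator
  `P := PmatBG k λ b`, `formCurv − formDiv = λ²T` (`formCurv_sub_formDiv_constBG`), `formCurv − formCross = ζλ²T`
  (`formCurv_sub_formCross_constBG`), `formDiv − formCross = −(1 − ζ)λ²T` (`formDiv_sub_formCross_constBG`): the left side of (IV.15)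
  differs from the (IV.16)-ordered operator («(∇)_μ…(∇)_ν», the DIV form) by `L = λ²T` and from the p.357-tl.10-ordered operator
  («(∂_μA_ν)(∂_νA_μ)», the CROSS form) by `L = ζλ²T` — in BOTH readings `L` at a constant background is «a term proportional to
  [A′_{l,μ}, A′_{l,ν}][A′_{s,μ}, A′_{s,ν}]», the class p.357 tl.2–4 assigns to `L`. (Which reading the authors intend is NOT decided here;
  finding (l) of the record: only positivity — (A.27) — separates them, files 15/17/18.)
* §4 (IV.10)/(IV.12) at a constant background, position space, file 16's jets (`curvatureSq_expand_constBG`): with `W_μν := (∇_B̄)_μA_ν −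
  (∇_B̄)_νA_μ`, `Σ_{μν}F_μν(A + B̄)·F_μν(A + B̄) = Σ W·W + 2λ²Σ[B̄_μ, B̄_ν]·[A_μ, A_ν] + (Σ F(B̄)·F(B̄) + 2ΣW·F(B̄) − 2λΣW·[A_μ, A_ν] +
  λ²Σ[A_μ, A_ν]·[A_μ, A_ν])` — i.e. besides the Gaussian term of (IV.10) the only piece QUADRATIC in the small field is the paramagnetic
  cross term `−2λΣF_μν(B̄)·[A_μ, A_ν] = 2λ²·Σ[B̄_μ, B̄_ν]·[A_μ, A_ν]`, which carries «one commutator [A′_s, A′_s]» and therefore sits in `H`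
  by (IV.12) (a «two background fields in the form of a commutator» vertex, p.353) — NOT in the Gaussian measure. Together with §3: at a
  constant background every term quadratic in `A′_s` that (IV.10)–(IV.15) leave outside `⟨A′_sΔ_BA′_s⟩` is a multiple of the one
  invariant `Σ_{μν}[B̄_μ, B̄_ν]·[A_μ, A_ν]`.

**What is NOT claimed.** Anything with the cut-off factors `(κʲ)^{1/2}χ_Δ(κʲ)^{1/2}` of (IV.16) or the convolutions `κ_j ∗`, `κ^j ∗` of
(II.50) in place (at the zero-mode background they enter only through a momentum-dependent weight multiplying `λ`, file 22
`nablaPrime_zeroModeBG`; every identity below holds pointwise in the momentum for every real `λ`, so it applies with that weight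
substituted for `λ`); the «derivatives acting on B′_l» part of `L` (piecewise-constant backgrounds); which index order of `Δ_B` the authors
intend; anything about domination/«dominable»; anything analytic or functional-integral. Nothing here bears on Bałaban's papers; nothing
is continuum YM₄ on T⁴, nothing lifts the infrared cutoff, nothing is Clay.
-/

open Complex Matrix Finset

namespace Literature.MathematicalPhysics.QuantumFieldTheory.MagnenRivasseauSeneor1993

namespace CovariantIBP

open FeynmanGauge HomotheticA27 ConstantBackground SectIV TruncatedGauge MainStatement

/-! ## §1 The adjoint action of su(2) ≅ (ℝ³, ×) as 3 × 3 matrices -/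

/-- A real colour vector (components `a = 1, 2, 3` of su(2), p.328 tl.16–17, here `Fin 3`) read in `ℂ³` (componentwise cast).
[cite: MagnenRivasseauSeneor1993, §II.A p.328 tl.16–17] -/
def cvec (c : Fin 3 → ℝ) : Fin 3 → ℂ := fun a => (c a : ℂ)

/-- Components of the cast. [cite: MagnenRivasseauSeneor1993, §II.A p.328 tl.16–17] -/
@[simp] theorem cvec_apply (c : Fin 3 → ℝ) (a : Fin 3) : cvec c a = (c a : ℂ) := rfl

/-- Real colour vectors are fixed by complex conjugation. [cite: MagnenRivasseauSeneor1993, §II.A p.328 tl.16–17] -/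
@[simp] theorem star_cvec (c : Fin 3 → ℝ) : star (cvec c) = cvec c := by
  ext a; simp [cvec]

/-- The cast commutes with the su(2) bracket (cross product). [cite: MagnenRivasseauSeneor1993, §II.A p.328 tl.32–33] -/
theorem cvec_cross (c d : Fin 3 → ℝ) : cvec (c ⨯₃ d) = cvec c ⨯₃ cvec d := by
  ext a; fin_cases a <;> simp [cvec, cross_apply]

/-- The cast is `ℝ`-linear: scalar multiples. [cite: MagnenRivasseauSeneor1993, §II.A p.328] -/
theorem cvec_smul (r : ℝ) (c : Fin 3 → ℝ) : cvec (r • c) = (r : ℂ) • cvec c := by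
  ext a; simp [cvec]

/-- The cast is additive-inverse compatible. [cite: MagnenRivasseauSeneor1993, §II.A p.328] -/
theorem cvec_neg (c : Fin 3 → ℝ) : cvec (-c) = -cvec c := by
  ext a; simp [cvec]

/-- `ad c`, the matrix of `e ↦ c ⨯₃ e` on `ℂ³` — the adjoint action of the colour vector `c` («[A^a_μ, A^b_ν] = ε^c_{ab}A^a_μA^b_ν is the
wedge product», p.328; mrs-lit-1's `TruncatedGauge.bracket` = `crossProduct`). [cite: MagnenRivasseauSeneor1993, §II.A p.328 tl.32–33] -/
def adMat (c : Fin 3 → ℂ) : Matrix (Fin 3) (Fin 3) ℂ :=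
  !![0, -c 2, c 1; c 2, 0, -c 0; -c 1, c 0, 0]

/-- `ad c` acts as the cross product. [cite: MagnenRivasseauSeneor1993, §II.A p.328 tl.32–33] -/
theorem adMat_mulVec (c e : Fin 3 → ℂ) : adMat c *ᵥ e = c ⨯₃ e := by
  ext i
  fin_cases i <;> simp [adMat, mulVec, dotProduct, Fin.sum_univ_three, cross_apply] <;> ring

/-- `ad` is linear: scalars. [cite: MagnenRivasseauSeneor1993, §II.A p.328] -/
theorem adMat_smul (r : ℂ) (c : Fin 3 → ℂ) : adMat (r • c) = r • adMat c := by
  ext i j; fin_cases i <;> fin_cases j <;> simp [adMat]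

/-- `ad` is linear: negation. [cite: MagnenRivasseauSeneor1993, §II.A p.328] -/
theorem adMat_neg (c : Fin 3 → ℂ) : adMat (-c) = -adMat c := by
  ext i j; fin_cases i <;> fin_cases j <;> simp [adMat]

/-- For a REAL colour vector `ad c` is anti-Hermitian (real antisymmetric). [cite: MagnenRivasseauSeneor1993, §II.A p.328 tl.16–17, tl.32–33] -/
theorem adMat_conjTranspose (c : Fin 3 → ℝ) : (adMat (cvec c))ᴴ = -adMat (cvec c) := by
  ext i j; fin_cases i <;> fin_cases j <;> simp [adMat, conjTranspose_apply]

/-- **Jacobi as a commutator**: `ad c · ad d − ad d · ad c = ad(c ⨯₃ d)` (for all complex colour vectors).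
[cite: MagnenRivasseauSeneor1993, §II.A p.328 tl.32–33] -/
theorem adMat_commutator (c d : Fin 3 → ℂ) : adMat c * adMat d - adMat d * adMat c = adMat (c ⨯₃ d) := by
  ext i j
  fin_cases i <;> fin_cases j <;> simp [adMat, cross_apply] <;> ring

/-! ## §2 «D_μ = iP_μ» for a GENERAL constant background: `P_μ = k_μ + iλ·ad(b_μ)` -/

/-- **The covariant momentum of a constant background** `b = (b_μ)_{μ<4}`, `b_μ ∈ ℝ³ ≅ su(2)`, at momentum `k` and coupling `λ`:
`P_μ := k_μ·1 + iλ·ad(b_μ)`, so that `iP_μ = ik_μ − λ[b_μ, ·]` is (II.5) «D_μ = ∂_μ − λ[A_μ, ·]» at `∂_μ → ik_μ` («D_μ = iP_μ (in Fourier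
space)», p.369 tl.22–23; at the two-component background these are the printed (VI.6), `PmatBG_bg2`).
[cite: MagnenRivasseauSeneor1993, §VI p.369 tl.22–23, (VI.6) p.369; (II.5) p.329 tl.10–11; §II.A p.328 tl.28] -/
def PmatBG (k : Fin 4 → ℝ) (lam : ℝ) (b : Fin 4 → Fin 3 → ℝ) (μ : Fin 4) : Matrix (Fin 3) (Fin 3) ℂ :=
  ((k μ : ℝ) : ℂ) • (1 : Matrix (Fin 3) (Fin 3) ℂ) + (I * (lam : ℂ)) • adMat (cvec (b μ))

/-- `P_μ e = k_μe + iλ(b_μ ⨯₃ e)`. [cite: MagnenRivasseauSeneor1993, §VI p.369 tl.22, (VI.6) p.369] -/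
theorem PmatBG_mulVec (k : Fin 4 → ℝ) (lam : ℝ) (b : Fin 4 → Fin 3 → ℝ) (μ : Fin 4) (e : Fin 3 → ℂ) :
    PmatBG k lam b μ *ᵥ e = ((k μ : ℝ) : ℂ) • e + (I * (lam : ℂ)) • (cvec (b μ) ⨯₃ e) := by
  rw [PmatBG, add_mulVec, smul_mulVec, smul_mulVec, one_mulVec, adMat_mulVec]

/-- **«D_μ = iP_μ»**: `i·(P_μ e) = (ik_μ)e − λ(b_μ ⨯₃ e)` — (II.5) `D_μ = ∂_μ − λ[B_μ, ·]` in momentum space at a constant background.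
[cite: MagnenRivasseauSeneor1993, §VI p.369 tl.22–23; (II.5) p.329 tl.10–11; §II.A p.328 tl.28] -/
theorem I_smul_PmatBG_mulVec (k : Fin 4 → ℝ) (lam : ℝ) (b : Fin 4 → Fin 3 → ℝ) (μ : Fin 4) (e : Fin 3 → ℂ) :
    I • (PmatBG k lam b μ *ᵥ e) = (I * ((k μ : ℝ) : ℂ)) • e - (lam : ℂ) • (cvec (b μ) ⨯₃ e) := by
  rw [PmatBG_mulVec, smul_add, smul_smul, smul_smul, ← mul_assoc, Complex.I_mul_I, neg_one_mul, neg_smul, sub_eq_add_neg]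

/-- **`P_μ` is Hermitian** (real background, real momentum) — the two «integrations by parts» of p.357 in Parseval form.
[cite: MagnenRivasseauSeneor1993, §IV p.357 tl.7–9; §VI (VI.6) p.369] -/
theorem PmatBG_conjTranspose (k : Fin 4 → ℝ) (lam : ℝ) (b : Fin 4 → Fin 3 → ℝ) (μ : Fin 4) :
    (PmatBG k lam b μ)ᴴ = PmatBG k lam b μ := by
  ext i j
  fin_cases i <;> fin_cases j <;> simp [PmatBG, adMat, conjTranspose_apply]

/-- Plumbing: the commutator of two «scalar + t·X» matrices is `t²·[X, Y]`. [cite: MagnenRivasseauSeneor1993, §IV p.357 tl.12–16] -/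
theorem smul_one_add_commutator (a c t : ℂ) (X Y : Matrix (Fin 3) (Fin 3) ℂ) :
    (a • (1 : Matrix (Fin 3) (Fin 3) ℂ) + t • X) * (c • (1 : Matrix (Fin 3) (Fin 3) ℂ) + t • Y) -
        (c • (1 : Matrix (Fin 3) (Fin 3) ℂ) + t • Y) * (a • (1 : Matrix (Fin 3) (Fin 3) ℂ) + t • X) =
      (t * t) • (X * Y - Y * X) := by
  simp only [add_mul, mul_add, Matrix.smul_mul, Matrix.mul_smul, Matrix.one_mul, Matrix.mul_one, smul_smul, smul_sub]
  module

/-- **`[P_μ, P_ν] = −λ²·ad(b_μ ⨯₃ b_ν)`** — the commutator of the covariant momenta of a constant background is the adjoint action of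
the background commutator (Jacobi); this is the «term proportional to [A′_{l,μ}, A′_{l,ν}]» of p.357 tl.15–16 at operator level, for every
four-component constant su(2) background (file 15's `Pmat_commutator_12` is its two-component instance).
[cite: MagnenRivasseauSeneor1993, §IV p.357 tl.12–16; §II.A p.328 tl.32–33] -/
theorem PmatBG_commutator (k : Fin 4 → ℝ) (lam : ℝ) (b : Fin 4 → Fin 3 → ℝ) (μ ν : Fin 4) :
    PmatBG k lam b μ * PmatBG k lam b ν - PmatBG k lam b ν * PmatBG k lam b μ =
      -((lam : ℂ) ^ 2) • adMat (cvec (b μ ⨯₃ b ν)) := by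
  unfold PmatBG
  rw [smul_one_add_commutator, adMat_commutator, ← cvec_cross]
  congr 1
  rw [← mul_assoc, mul_comm (I * (lam : ℂ)) I, ← mul_assoc, Complex.I_mul_I]
  ring

/-- The constant-background jet of file 16: values `b`, all derivatives `0` («if the background field is constant», p.357 tl.14;
«∂B ≅ 0 for a low momentum field», p.354 tl.25–26). [cite: MagnenRivasseauSeneor1993, §IV p.357 tl.14, p.354 tl.25–26] -/
def constJet (b : Fin 4 → Fin 3 → ℝ) : FieldJet := ⟨b, fun _ _ => 0⟩

/-- (II.1) at a constant background: `F_μν(B̄) = −λ[B̄_μ, B̄_ν]`. [cite: MagnenRivasseauSeneor1993, §II.A (II.1) p.328 tl.30; §IV p.357 tl.14] -/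
theorem curvature_constJet (lam : ℝ) (b : Fin 4 → Fin 3 → ℝ) (μ ν : Fin 4) :
    curvature lam (constJet b) μ ν = -(lam • bracket (b μ) (b ν)) := by
  simp [curvature, constJet]

/-- **`[P_μ, P_ν] = λ·ad F_μν(B̄)`** with `F` the printed (II.1) of the constant background (so `[D_μ, D_ν] = i²[P_μ, P_ν] = −λ·ad F_μν(B̄)`
for `D = ∂ − λ[B̄, ·]`). [cite: MagnenRivasseauSeneor1993, §II.A (II.1) p.328 tl.30, tl.28; §IV p.357 tl.12–16] -/
theorem PmatBG_commutator_eq_curvature (k : Fin 4 → ℝ) (lam : ℝ) (b : Fin 4 → Fin 3 → ℝ) (μ ν : Fin 4) :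
    PmatBG k lam b μ * PmatBG k lam b ν - PmatBG k lam b ν * PmatBG k lam b μ =
      (lam : ℂ) • adMat (cvec (curvature lam (constJet b) μ ν)) := by
  rw [PmatBG_commutator, curvature_constJet, bracket_eq_crossProduct, cvec_neg, cvec_smul, adMat_neg, adMat_smul,
    smul_neg, smul_smul]
  rw [← neg_smul]
  congr 1
  ring

/-- The two-component background of p.369 as real colour vectors: `B̄₁ = u·e₁`, `B̄₂ = v·e₂`, `B̄₀ = B̄₃ = 0` (in print `u = x/λ`,
`v = y/λ`). [cite: MagnenRivasseauSeneor1993, §VI p.369 tl.11] -/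
def bg2 (u v : ℝ) : Fin 4 → Fin 3 → ℝ
  | 0 => ![0, 0, 0]
  | 1 => ![u, 0, 0]
  | 2 => ![0, v, 0]
  | 3 => ![0, 0, 0]

/-- The cast of `bg2` is file 22's `bgVec`. [cite: MagnenRivasseauSeneor1993, §VI p.369 tl.9–13] -/
theorem cvec_bg2 (u v : ℝ) (μ : Fin 4) : cvec (bg2 u v μ) = bgVec u v μ := by
  ext a; fin_cases μ <;> fin_cases a <;> simp [cvec, bg2, bgVec]

/-- **Dictionary with the printed (VI.6)**: at the two-component background the covariant momenta ARE file 9's `FeynmanGauge.Pmat` with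
`x = λu`, `y = λv`. [cite: MagnenRivasseauSeneor1993, §VI (VI.6) p.369, p.369 tl.9–13] -/
theorem PmatBG_bg2 (k : Fin 4 → ℝ) (lam u v : ℝ) (μ : Fin 4) :
    PmatBG k lam (bg2 u v) μ = Pmat (k 0) (k 1) (k 2) (k 3) (lam * u) (lam * v) μ := by
  ext i j
  fin_cases μ <;> fin_cases i <;> fin_cases j <;> simp [PmatBG, adMat, bg2, Pmat] <;> ring

/-- Consistency with file 15: at the two-component background `PmatBG_commutator` specialises to `HomotheticA27.Pmat_commutator_12`
(`[P₁, P₂] = xy·(0 1 0; −1 0 0; 0 0 0)`). [cite: MagnenRivasseauSeneor1993, §VI (VI.6) p.369; §IV p.357 tl.15–16] -/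
theorem PmatBG_bg2_commutator_12 (k : Fin 4 → ℝ) (lam u v : ℝ) :
    PmatBG k lam (bg2 u v) 1 * PmatBG k lam (bg2 u v) 2 - PmatBG k lam (bg2 u v) 2 * PmatBG k lam (bg2 u v) 1 =
      !![0, ((lam * u) * (lam * v) : ℂ), 0; -((lam * u) * (lam * v) : ℂ), 0, 0; 0, 0, 0] := by
  rw [PmatBG_commutator]
  ext i j
  fin_cases i <;> fin_cases j <;> simp [adMat, bg2, cross_apply] <;> ring

/-- **A GENERAL constant background as a momentum-space coefficient function** (supported at the zero mode `q = 0`, value `b_μ` there;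
file 22's READING (CB) with all four components free). [cite: MagnenRivasseauSeneor1993, §VI p.369 tl.9–13, §II.A p.328 tl.13–15] -/
def constBG (b : Fin 4 → Fin 3 → ℝ) : (Fin 4 → ℤ) → Fin 4 → Fin 3 → ℂ :=
  fun q μ => if q = 0 then cvec (b μ) else 0

/-- File 22's two-component `zeroModeBG` is the instance `b = bg2 u v`. [cite: MagnenRivasseauSeneor1993, §VI p.369 tl.9–13] -/
theorem constBG_bg2 (u v : ℝ) : constBG (bg2 u v) = zeroModeBG u v := by
  funext q μ
  by_cases hq : q = 0
  · subst hq; simp [constBG, cvec_bg2]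
  · simp [constBG, hq]

/-- **(II.5) ↦ `iP_μ` for every constant background**: mrs-lit-1's typed covariant derivative `covDCoeff` («D = ∂ − λ[A, ·]» in momentum
space, with the wedge-product convolution) at the zero-mode background `constBG b` is, at every momentum `k` of the box, multiplication by
`i·PmatBG k λ b μ` — generalising file 22's `covDCoeff_zeroModeBG` from the two-component background to four free components.
[cite: MagnenRivasseauSeneor1993, (II.5) p.329 tl.10–11; §VI p.369 tl.22, (VI.6) p.369] -/
theorem covDCoeff_constBG (T : Finset (Fin 4 → ℤ)) (lam : ℝ) (b : Fin 4 → Fin 3 → ℝ) (η : (Fin 4 → ℤ) → Fin 3 → ℂ) (μ : Fin 4)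
    {k : Fin 4 → ℤ} (hk : k ∈ insert (0 : Fin 4 → ℤ) T) :
    covDCoeff T lam (constBG b) η μ k = I • (PmatBG (fun ν => (k ν : ℝ)) lam b μ *ᵥ η k) := by
  unfold covDCoeff
  rw [convCross_of_left_zeroMode (insert 0 T) (Finset.mem_insert_self 0 T)
    (X := fun q => constBG b q μ) (fun q hq => by simp [constBG, hq]) η hk]
  rw [I_smul_PmatBG_mulVec, dCoeff_eq_smul]
  simp [constBG]

/-! ## §3 p.357 tl.12–16: the covariant integration by parts and its remainder `λ²·Σ[B̄_μ, B̄_ν]·[Ā_μ, A_ν]` -/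

/-- **The remainder invariant** `T(b, a) := Σ_{μν} (b_μ ⨯₃ b_ν)·(ā_μ ⨯₃ a_ν)` — «a term proportional to [A′_{l,μ}, A′_{l,ν}][A′_{s,μ}, A′_{s,ν}]»
(p.357 tl.15–16), in the trace form of su(2) ≅ (ℝ³, ×) and Parseval (sesquilinear) form. [cite: MagnenRivasseauSeneor1993, §IV p.357 tl.15–16] -/
def commTerm (b : Fin 4 → Fin 3 → ℝ) (a : Fin 4 → Fin 3 → ℂ) : ℂ :=
  ∑ μ, ∑ ν, cvec (b μ ⨯₃ b ν) ⬝ᵥ (star (a μ) ⨯₃ a ν)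

/-- For an ABELIAN constant background (pairwise commuting `b_μ`) the remainder vanishes: the integration by parts is exact.
[cite: MagnenRivasseauSeneor1993, §IV p.357 tl.12–16] -/
theorem commTerm_eq_zero_of_cross_eq_zero {b : Fin 4 → Fin 3 → ℝ} (hb : ∀ μ ν, b μ ⨯₃ b ν = 0) (a : Fin 4 → Fin 3 → ℂ) :
    commTerm b a = 0 := by
  unfold commTerm
  refine Finset.sum_eq_zero fun μ _ => Finset.sum_eq_zero fun ν _ => ?_
  have h0 : cvec (b μ ⨯₃ b ν) = 0 := by
    rw [hb μ ν]; ext a; simp [cvec]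
  rw [h0, zero_dotProduct]

/-- **p.357 tl.12–16, kernel-checked for every constant su(2) background**: `‖Σ_μP_μa_μ‖² − Σ_{μν}⟨P_νa_μ, P_μa_ν⟩ = λ²·T(b, a)` — i.e.
`∫(∇_B̄·A)² = ∫Σ_μΣ_ν(∇_μA_ν)(∇_νA_μ) + λ²·Σ_{μν}∫[B̄_μ, B̄_ν]·[A_μ, A_ν]` in Parseval form at each momentum: «if the background field is
constant … the formula of integration by parts is still true up to a term proportional to [A′_{l,μ}, A′_{l,ν}][A′_{s,μ}, A′_{s,ν}]».
Mechanism: two integrations by parts = Hermiticity of `P_μ` (`divSq_eq_sum`, `crossM_eq_sum` of file 15), remainder = `Σ⟨a_μ, [P_μ, P_ν]a_ν⟩`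
= `−λ²Σ ā_μ·((b_μ ⨯₃ b_ν) ⨯₃ a_ν)` (`PmatBG_commutator`) = `λ²T` (invariance of the trace form).
[cite: MagnenRivasseauSeneor1993, §IV p.357 tl.12–16, (IV.15) p.356] -/
theorem divSq_sub_crossM_constBG (k : Fin 4 → ℝ) (lam : ℝ) (b : Fin 4 → Fin 3 → ℝ) (a : Fin 4 → Fin 3 → ℂ) :
    divSq (PmatBG k lam b) a - crossM (PmatBG k lam b) a = (lam : ℂ) ^ 2 * commTerm b a := by
  have hP : ∀ μ, (PmatBG k lam b μ)ᴴ = PmatBG k lam b μ := PmatBG_conjTranspose k lam b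
  rw [divSq_eq_sum hP, crossM_eq_sum hP, ← Finset.sum_sub_distrib]
  unfold commTerm
  rw [Finset.mul_sum]
  refine Finset.sum_congr rfl fun μ _ => ?_
  rw [← Finset.sum_sub_distrib, Finset.mul_sum]
  refine Finset.sum_congr rfl fun ν _ => ?_
  rw [← dotProduct_sub, ← sub_mulVec, PmatBG_commutator, smul_mulVec, adMat_mulVec, dotProduct_smul,
    triple_product_permutation, ← cross_anticomm (star (a μ)) (a ν), dotProduct_neg, smul_eq_mul]
  ring

/-- **(IV.15) at a constant background, DIV reading of (IV.16)**: `LHS(IV.15) − ⟨A, Δ_B^{div}A⟩ = λ²·T` — with `Δ_B` the block operator in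
the printed index order «(∇)_μ…(∇)_ν» (file 15 `formDiv`), the remainder `L` is exactly the commutator invariant.
[cite: MagnenRivasseauSeneor1993, §IV (IV.15)–(IV.16) p.356, p.357 tl.2–4, tl.12–16] -/
theorem formCurv_sub_formDiv_constBG (k : Fin 4 → ℝ) (lam : ℝ) (b : Fin 4 → Fin 3 → ℝ) (a : Fin 4 → Fin 3 → ℂ) (ζ : ℝ) :
    formCurv (PmatBG k lam b) a ζ - formDiv (PmatBG k lam b) a ζ = (lam : ℂ) ^ 2 * commTerm b a := by
  rw [← divSq_sub_crossM_constBG k lam b a]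
  unfold formCurv formDiv
  ring

/-- **(IV.15) at a constant background, CROSS reading** (the operator of p.357 tl.10 «Σ_μΣ_ν(∂_μA_ν)² + (ζ − 1)Σ_μΣ_ν(∂_μA_ν)(∂_νA_μ)»,
file 15 `formCross`): `LHS(IV.15) − ⟨A, Δ_B^{cross}A⟩ = ζλ²·T` — again a multiple of the commutator invariant.
[cite: MagnenRivasseauSeneor1993, §IV (IV.15) p.356, p.357 tl.2–4, tl.10, tl.12–16] -/
theorem formCurv_sub_formCross_constBG (k : Fin 4 → ℝ) (lam : ℝ) (b : Fin 4 → Fin 3 → ℝ) (a : Fin 4 → Fin 3 → ℂ) (ζ : ℝ) :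
    formCurv (PmatBG k lam b) a ζ - formCross (PmatBG k lam b) a ζ = (ζ : ℂ) * ((lam : ℂ) ^ 2 * commTerm b a) := by
  rw [← divSq_sub_crossM_constBG k lam b a]
  unfold formCurv formCross
  ring

/-- **DIV minus CROSS reading at a constant background**: `⟨A, Δ_B^{div}A⟩ − ⟨A, Δ_B^{cross}A⟩ = −(1 − ζ)λ²·T` — file 15's abstract
`formDiv_sub_formCross` with the commutator evaluated: the two candidate Gaussian operators differ exactly by a multiple of
«[A′_{l,μ}, A′_{l,ν}][A′_{s,μ}, A′_{s,ν}]», a term the print treats as interaction (`L`, p.357 tl.2–4).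
[cite: MagnenRivasseauSeneor1993, §IV (IV.15)–(IV.16) p.356, p.357 tl.2–16] -/
theorem formDiv_sub_formCross_constBG (k : Fin 4 → ℝ) (lam : ℝ) (b : Fin 4 → Fin 3 → ℝ) (a : Fin 4 → Fin 3 → ℂ) (ζ : ℝ) :
    formDiv (PmatBG k lam b) a ζ - formCross (PmatBG k lam b) a ζ = -(1 - (ζ : ℂ)) * ((lam : ℂ) ^ 2 * commTerm b a) := by
  rw [← divSq_sub_crossM_constBG k lam b a]
  unfold formDiv formCross
  ring

/-! ### §3b The same identity for mrs-lit-1's typed (II.5) `covDCoeff` at a zero-mode background (per momentum of the window) -/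

/-- Plumbing: `⟨i·u, i·w⟩ = ⟨u, w⟩`. [cite: MagnenRivasseauSeneor1993, §VI p.369 tl.22–23] -/
theorem star_I_smul_dotProduct_I_smul (u w : Fin 3 → ℂ) : star (I • u) ⬝ᵥ (I • w) = star u ⬝ᵥ w := by
  rw [star_smul, smul_dotProduct, dotProduct_smul, smul_smul, Complex.star_def, Complex.conj_I, smul_eq_mul]
  rw [show -I * I = 1 by rw [neg_mul, Complex.I_mul_I, neg_neg], one_mul]

/-- **p.357 tl.12–16 for the paper's own (II.5) as typed by mrs-lit-1**, at every momentum `k` of the window `{0} ∪ T` and every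
constant (zero-mode) background `constBG b`: with `(D_μX)~(k) = covDCoeff T λ (constBG b) X μ k`,
`‖Σ_μ(D_μA_μ)~(k)‖² − Σ_{μν}⟨(D_νA_μ)~(k), (D_μA_ν)~(k)⟩ = λ²·T(b, Ã(k))` — summing over `k` (Parseval) this is
«∫(∇_B̄·A)² − ∫Σ_μΣ_ν(∇_μA_ν)(∇_νA_μ) = a term proportional to [B̄_μ, B̄_ν][A_μ, A_ν]» for a constant background.
[cite: MagnenRivasseauSeneor1993, §IV p.357 tl.12–16; (II.5) p.329 tl.10–11; §VI p.369 tl.22–23] -/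
theorem covDCoeff_ibp_constBG (T : Finset (Fin 4 → ℤ)) (lam : ℝ) (b : Fin 4 → Fin 3 → ℝ)
    (A : (Fin 4 → ℤ) → Fin 4 → Fin 3 → ℂ) {k : Fin 4 → ℤ} (hk : k ∈ insert (0 : Fin 4 → ℤ) T) :
    star (∑ μ, covDCoeff T lam (constBG b) (fun q => A q μ) μ k) ⬝ᵥ (∑ μ, covDCoeff T lam (constBG b) (fun q => A q μ) μ k)
        - ∑ μ, ∑ ν, star (covDCoeff T lam (constBG b) (fun q => A q μ) ν k) ⬝ᵥ
            (covDCoeff T lam (constBG b) (fun q => A q ν) μ k) =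
      (lam : ℂ) ^ 2 * commTerm b (A k) := by
  simp only [covDCoeff_constBG T lam b _ _ hk, ← Finset.smul_sum, star_I_smul_dotProduct_I_smul]
  exact divSq_sub_crossM_constBG (fun ν => (k ν : ℝ)) lam b (A k)

/-! ## §4 (IV.10)/(IV.12) at a constant background (position space, file 16's jets): the paramagnetic term sits in `H` -/

/-- `W_μν := (∇_B̄)_μA_ν − (∇_B̄)_νA_μ`, the small-field covariant curl whose square is the Gaussian term of (IV.10) (pointwise, file 16's
`covDeriv` at the constant jet). [cite: MagnenRivasseauSeneor1993, §IV (IV.10) p.356, (IV.4) p.354] -/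
def covCurl (lam : ℝ) (b : Fin 4 → Fin 3 → ℝ) (A : FieldJet) (μ ν : Fin 4) : Fin 3 → ℝ :=
  covDeriv lam (constJet b) A μ ν - covDeriv lam (constJet b) A ν μ

/-- Pointwise expansion of `F_μν(A + B̄)·F_μν(A + B̄)` at a constant background ((IV.4) squared, with `F_μν(B̄) = −λ[B̄_μ, B̄_ν]`):
`= W·W + 2λ²[B̄_μ, B̄_ν]·[A_μ, A_ν] + (F(B̄)·F(B̄) + 2W·F(B̄) − 2λW·[A_μ, A_ν] + λ²[A_μ, A_ν]·[A_μ, A_ν])`.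
[cite: MagnenRivasseauSeneor1993, §IV (IV.4) p.354, (IV.10) p.356] -/
theorem curvature_dot_expand_constBG (lam : ℝ) (b : Fin 4 → Fin 3 → ℝ) (A : FieldJet) (μ ν : Fin 4) :
    curvature lam (A.add (constJet b)) μ ν ⬝ᵥ curvature lam (A.add (constJet b)) μ ν =
      covCurl lam b A μ ν ⬝ᵥ covCurl lam b A μ ν
        + 2 * lam ^ 2 * (bracket (b μ) (b ν) ⬝ᵥ bracket (A.val μ) (A.val ν))
        + (curvature lam (constJet b) μ ν ⬝ᵥ curvature lam (constJet b) μ ν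
            + 2 * (covCurl lam b A μ ν ⬝ᵥ curvature lam (constJet b) μ ν)
            - 2 * lam * (covCurl lam b A μ ν ⬝ᵥ bracket (A.val μ) (A.val ν))
            + lam ^ 2 * (bracket (A.val μ) (A.val ν) ⬝ᵥ bracket (A.val μ) (A.val ν))) := by
  rw [curvature_add]
  have hW : covDeriv lam (constJet b) A μ ν - covDeriv lam (constJet b) A ν μ = covCurl lam b A μ ν := rfl
  rw [hW]
  set W := covCurl lam b A μ ν
  set C := bracket (A.val μ) (A.val ν)
  have hF : curvature lam (constJet b) μ ν = -(lam • bracket (b μ) (b ν)) := curvature_constJet lam b μ ν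
  set Bc := bracket (b μ) (b ν)
  rw [hF]
  simp only [dotProduct_add, add_dotProduct, dotProduct_sub, sub_dotProduct, dotProduct_neg, neg_dotProduct, dotProduct_smul,
    smul_dotProduct, smul_eq_mul, dotProduct_comm C W, dotProduct_comm Bc W, dotProduct_comm Bc C]
  ring

/-- **(IV.10)/(IV.12) at a constant background**: summing the pointwise expansion over `μ, ν`,
`Σ_{μν}F_μν(A + B̄)·F_μν(A + B̄) = Σ W·W + 2λ²·Σ[B̄_μ, B̄_ν]·[A_μ, A_ν] + (Σ F(B̄)·F(B̄) + 2ΣW·F(B̄) − 2λΣW·[A_μ, A_ν] + λ²Σ[A_μ, A_ν]·[A_μ, A_ν])`: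
besides the Gaussian term `ΣW·W` of (IV.10), the terms of `H` at a constant background are listed; the ONLY one quadratic in the small
field `A` is the paramagnetic `2λ²Σ[B̄_μ, B̄_ν]·[A_μ, A_ν]` (= `−2λΣF_μν(B̄)·[A_μ, A_ν]`), which carries «one commutator [A′_s, A′_s]» and is
therefore assigned to `H` by (IV.12) — the same invariant as §3's remainder of `L`. (The others are `A`-independent, linear, cubic and
quartic in `A` respectively.) [cite: MagnenRivasseauSeneor1993, §IV (IV.10), (IV.12) p.356, (IV.4) p.354, p.353 tl.29–32] -/
theorem curvatureSq_expand_constBG (lam : ℝ) (b : Fin 4 → Fin 3 → ℝ) (A : FieldJet) :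
    ∑ μ, ∑ ν, curvature lam (A.add (constJet b)) μ ν ⬝ᵥ curvature lam (A.add (constJet b)) μ ν =
      (∑ μ, ∑ ν, covCurl lam b A μ ν ⬝ᵥ covCurl lam b A μ ν)
        + 2 * lam ^ 2 * (∑ μ, ∑ ν, bracket (b μ) (b ν) ⬝ᵥ bracket (A.val μ) (A.val ν))
        + (∑ μ, ∑ ν, (curvature lam (constJet b) μ ν ⬝ᵥ curvature lam (constJet b) μ ν
            + 2 * (covCurl lam b A μ ν ⬝ᵥ curvature lam (constJet b) μ ν)
            - 2 * lam * (covCurl lam b A μ ν ⬝ᵥ bracket (A.val μ) (A.val ν))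
            + lam ^ 2 * (bracket (A.val μ) (A.val ν) ⬝ᵥ bracket (A.val μ) (A.val ν)))) := by
  simp_rw [curvature_dot_expand_constBG]
  simp only [Finset.sum_add_distrib, Finset.mul_sum]

end CovariantIBP

end Literature.MathematicalPhysics.QuantumFieldTheory.MagnenRivasseauSeneor1993
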